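import Literature.AnabelianGeometry.SemiGraphs.TemperedCoveringsSubgraphBTemp
import Literature.AnabelianGeometry.SemiGraphs.TemperedVerticial
import Literature.AnabelianGeometry.SemiGraphs.Temperoids
import Literature.AlgebraicGeometry.Frobenioids.QuasiTemperoidConnected
import HarnessLib

/-!
# One-vertex, edgeless semi-graphs of anabelioids (ANY presentation): every covering is tempered,
# `B^temp(𝒢) ≌ B^temp(Π_v)` by `S ↦ S_v`, and the explicit chart `π₁^temp(𝒢) = Π_v`; the chart of the
# edgeless single-vertex restriction `𝒢_{⟨{v}, ∅⟩}` ([SemiAnbd] Def. 3.5, Prop. 3.6 (ii), Thm. 3.7 (i))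

Mochizuki, *Semi-graphs of anabelioids*, Publ. RIMS **42** (2006) [MochizukiSemiAnbd2006], §3 Def. 3.5
(i)(ii) p. 37 (coverings, tempered coverings: "there exists a finite étale covering … which splits the
restriction of [this connected component of] `G' → G` to `G_c`"), p. 38 / Prop. 3.6 (ii)
(`B^temp(π₁^temp(𝒢)) ⥲ B^temp(𝒢)`), Thm. 3.7 (i) p. 40 (verticial subgroups), Rmk. 3.1.1 p. 33 ("every
profinite group is tempered"), Def. 2.1 p. 24 (the restriction `𝒢_ℍ` to a sub-semi-graph); Mochizuki,
*Inter-universal Teichmüller theory I*, §2 p. 44 (decomposition groups `Π^tp_ℍ ⊆ Π^tp_𝔾` of sub-semi-graphs)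
[cite: Mochizuki2012, IUTchI §2 p.44].

DEFINITIONS file (abc-iut cell, layer L3, row «DECOMP@SINGLE-VERTEX» = GAP row G-w5d028-2 sub-row γ-2,
L3-lead ruling β50 (1); seat abc-iut-L3-t6 gen 7).  abc-iut-L3-t2's `OneVertexWitnessChart.lean` proves,
for the SPECIFIC presentation `OneVertex.graph P` (vertex type `PUnit`, edge type `PEmpty`) and a
`LevelFamily` on `P`, that every covering is tempered and builds the chart `OneVertex.chart` with group `P`
on the nose.  The restriction `𝒢.restrict ⟨{v}, ∅⟩` of an arbitrary semi-graph of anabelioids to the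
edgeless single-vertex sub-semi-graph `{v}` (abc-iut-L3-t2's `TemperedCoveringsSubgraph.lean`) has
SUBTYPE vertex / edge types instead, and no level family is at hand.  This file redoes the construction
for an ARBITRARY presentation `𝒢` with `Unique 𝒢.graph.Vertex`, `IsEmpty 𝒢.graph.Edge` and NO extra data
(the open normal subgroups of the profinite `Π_v` supplied by Mathlib's
`ProfiniteGrp.exist_openNormalSubgroup_sub_open_nhds_of_one` replace the level family):

* `castSV` / `castSVHom` / `CovObj.castSVIso` — transport of vertex fibres along an equality of vertices
  (the vertex twin of abc-iut-L3-t2's `castSE`);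
* `OneVertexEdgeless.covObjAt v X` — the covering with fibre `X` at `v` (transported to every, i.e. the,
  vertex), functorial in `X` (`covFunctorAt`);
* `OneVertexEdgeless.isTempered_covObj` — EVERY covering is tempered: the stabiliser of a point `t ∈ S_v`
  is open, hence contains an open normal `N ⊴ Π_v`; the component of `t` is `{g · t}` and the finite
  covering `Π_v/N` splits it (Def. 3.5 (ii));
* `OneVertexEdgeless.temperedEquivAt v : BTempCat 𝒢 ≌ BTemp (𝒢.Gv v)` — `B^temp(𝒢) ≌ B^temp(Π_v)` by
  `S ↦ S_v`, with `temperedEquivAt_functor : (…).functor = ι ⋙ restrictV 𝒢 v` definitionally;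
* `OneVertexEdgeless.chartAt v : TemperedPiChart 𝒢` — the EXPLICIT tempered fundamental group
  `π₁^temp(𝒢) = Π_v` on the nose (Rmk. 3.1.1: `Π_v` is tempered; [IUTchI] Rmk. 2.5.3 (i) (T6) asks for
  second countability, a hypothesis);
* the single-vertex specialisation: `uniqueVertexRestrictSingleton`, `isEmpty_edge_restrictSingleton`,
  `chartSingleVertex 𝒢 v : TemperedPiChart (𝒢.restrict ⟨{v}, ∅⟩)` with group `Π_v`, and the definitional
  identity `btempRestrict_comp_chartSingleVertex_functor :
  𝒢.btempRestrict ⟨{v}, ∅⟩ ⋙ (chartSingleVertex 𝒢 v).equiv.functor = ι ⋙ restrictV 𝒢 v` — the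
  restriction to the sub-semi-graph `{v}` read through this chart IS the restriction `S ↦ S_v` of
  Thm. 3.7 (i); the proof-only companion `TemperedDecompositionSingleVertex.lean` turns this into
  `decompSubgroups c ⟨{v}, ∅⟩ = verticialSubgroups c v` (abc-iut-w4-d052's vocabulary).

Definitions + definitional laws + the temperedness theorem; no instance, no notation, no `Prop` fact, no
statement of the paper is touched.  Nothing here takes a side on [IUTchIII] Cor. 3.12.
-/

noncomputable section

namespace Literature.AnabelianGeometry.SemiGraphs

namespace ProfiniteSemiGraph

open CategoryTheory Topology
open Literature.AlgebraicGeometry.Frobenioids.QuasiTemperoid.BTempConnected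
  (hom_ext_apply ρ_one_apply ρ_mul_apply ρ_inv_apply)

universe u

variable {𝒢 : ProfiniteSemiGraph.{u}}

/-! ### Transport of vertex fibres along an equality of vertices -/

/-- Transport of an object of `B^temp(Π_{v})` to `B^temp(Π_{w})` along an equality of vertices `v = w`
(bookkeeping; the identity when `v ≡ w`). [cite: MochizukiSemiAnbd2006, §3 p.36] -/
def castSV {v w : 𝒢.graph.Vertex} (h : v = w) (X : BTemp (𝒢.Gv v)) : BTemp (𝒢.Gv w) := h ▸ X

/-- Transport along a reflexive equality is the identity. [cite: MochizukiSemiAnbd2006, §3 p.36] -/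
@[simp] theorem castSV_rfl {v : 𝒢.graph.Vertex} (X : BTemp (𝒢.Gv v)) : castSV rfl X = X := rfl

/-- Transport of a morphism of `B^temp(Π_v)` along `v = w`. [cite: MochizukiSemiAnbd2006, §3 p.36] -/
def castSVHom {v w : 𝒢.graph.Vertex} (h : v = w) {X Y : BTemp (𝒢.Gv v)} (f : X ⟶ Y) :
    castSV h X ⟶ castSV h Y := by
  subst h
  exact f

/-- Transport of a morphism along a reflexive equality is the identity. [cite: MochizukiSemiAnbd2006, §3 p.36] -/
@[simp] theorem castSVHom_rfl {v : 𝒢.graph.Vertex} {X Y : BTemp (𝒢.Gv v)} (f : X ⟶ Y) :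
    castSVHom rfl f = f := rfl

/-- Transport of morphisms preserves identities. [cite: MochizukiSemiAnbd2006, §3 p.36] -/
@[simp] theorem castSVHom_id {v w : 𝒢.graph.Vertex} (h : v = w) (X : BTemp (𝒢.Gv v)) :
    castSVHom h (𝟙 X) = 𝟙 (castSV h X) := by
  subst h
  rfl

/-- Transport of morphisms preserves composition. [cite: MochizukiSemiAnbd2006, §3 p.36] -/
@[simp] theorem castSVHom_comp {v w : 𝒢.graph.Vertex} (h : v = w) {X Y Z : BTemp (𝒢.Gv v)} (f : X ⟶ Y)
    (g : Y ⟶ Z) : castSVHom h (f ≫ g) = castSVHom h f ≫ castSVHom h g := by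
  subst h
  rfl

/-- For a covering `S`, the fibre `S_w` is (by the identity) the transport of `S_v` along `v = w`.
[cite: MochizukiSemiAnbd2006, §3 p.36] -/
def CovObj.castSVIso (S : CovObj 𝒢) {v w : 𝒢.graph.Vertex} (h : v = w) : S.SV w ≅ castSV h (S.SV v) := by
  subst h
  exact Iso.refl _

/-- `castSVIso` along a reflexive equality is the identity isomorphism. [cite: MochizukiSemiAnbd2006, §3 p.36] -/
@[simp] theorem CovObj.castSVIso_rfl (S : CovObj 𝒢) {v : 𝒢.graph.Vertex} :
    S.castSVIso (rfl : v = v) = Iso.refl _ := rfl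

/-- Naturality of `castSVIso` in the covering. [cite: MochizukiSemiAnbd2006, §3 p.36] -/
theorem CovObj.castSVIso_hom_naturality {S T : CovObj 𝒢} (f : S ⟶ T) {v w : 𝒢.graph.Vertex} (h : v = w) :
    f.fV w ≫ (T.castSVIso h).hom = (S.castSVIso h).hom ≫ castSVHom h (f.fV v) := by
  subst h
  simp

/-! ### One-vertex, edgeless presentations: coverings are `Π_v`-sets -/

namespace OneVertexEdgeless

variable (𝒢 : ProfiniteSemiGraph.{u}) [Unique 𝒢.graph.Vertex] [IsEmpty 𝒢.graph.Edge]

/-- The covering of a one-vertex edgeless `𝒢` with fibre `X ∈ B^temp(Π_v)` at `v` (transported to every —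
i.e. the — vertex; no edges to glue). [cite: MochizukiSemiAnbd2006, Def 3.5(i) p.37] -/
def covObjAt (v : 𝒢.graph.Vertex) (X : BTemp (𝒢.Gv v)) : CovObj 𝒢 where
  SV := fun w => castSV (Subsingleton.elim v w) X
  SE := fun e => isEmptyElim e
  glue := fun b => (Function.isEmpty 𝒢.graph.edgeOf).elim b

/-- The fibre of `covObjAt v X` at `v` is `X` (definitionally). [cite: MochizukiSemiAnbd2006, Def 3.5(i) p.37] -/
@[simp] theorem covObjAt_SV_self (v : 𝒢.graph.Vertex) (X : BTemp (𝒢.Gv v)) : (covObjAt 𝒢 v X).SV v = X :=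
  rfl

/-- `X ↦ covObjAt v X` as a functor `B^temp(Π_v) ⥤ B^cov(𝒢)`. [cite: MochizukiSemiAnbd2006, Def 3.5(i) p.37] -/
def covFunctorAt (v : 𝒢.graph.Vertex) : BTemp (𝒢.Gv v) ⥤ CovObj 𝒢 where
  obj X := covObjAt 𝒢 v X
  map f :=
    { fV := fun w => castSVHom (Subsingleton.elim v w) f
      fE := fun e => isEmptyElim e
      comm := fun b => (Function.isEmpty 𝒢.graph.edgeOf).elim b }
  map_id _ := CovHom.ext (funext fun _ => castSVHom_id _ _) (funext fun e => isEmptyElim e)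
  map_comp _ _ := CovHom.ext (funext fun _ => castSVHom_comp _ _ _) (funext fun e => isEmptyElim e)

/-- The vertex component of `covFunctorAt v` at `v` is the given map (definitionally).
[cite: MochizukiSemiAnbd2006, Def 3.5(i) p.37] -/
@[simp] theorem covFunctorAt_map_fV_self (v : 𝒢.graph.Vertex) {X Y : BTemp (𝒢.Gv v)} (f : X ⟶ Y) :
    ((covFunctorAt 𝒢 v).map f).fV v = f := rfl

/-! ### Every covering is tempered -/

/-- A point of `Π/N` fixed by `g` witnesses `g ∈ N` (`N` normal, open; `Π` tempered).
[cite: MochizukiSemiAnbd2006, Rmk 3.1.2 p.33] -/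
theorem mem_of_fix_quotientObj {P : Type u} [Group P] [TopologicalSpace P] [IsTopologicalGroup P]
    (hP : IsTempered P) (N : Subgroup P) [N.Normal] (hN : IsOpen (N : Set P))
    (x : (BTemp.quotientObj P hP N hN).obj.V) (g : P) (h : (BTemp.quotientObj P hP N hN).obj.ρ g x = x) :
    g ∈ N := by
  change P ⧸ N at x
  induction x using QuotientGroup.induction_on with
  | H y =>
    change (g • (QuotientGroup.mk y : P ⧸ N)) = QuotientGroup.mk y at h
    rw [MulAction.Quotient.smul_mk, QuotientGroup.eq, smul_eq_mul, mul_inv_rev, mul_assoc] at h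
    have h' : g⁻¹ ∈ N := by
      have := ‹N.Normal›.conj_mem _ h y
      simpa [mul_assoc] using this
    simpa using N.inv_mem h'

omit [Unique 𝒢.graph.Vertex] in
/-- In an edgeless presentation, the connected component of the point `t ∈ S_v` consists of the points
`g · t ∈ S_v`. [cite: MochizukiSemiAnbd2006, Def 3.5(ii) p.37] -/
theorem exists_eq_ρ_of_sameComponent (S : CovObj 𝒢) (v : 𝒢.graph.Vertex) (t : (S.SV v).obj.V)
    (q : S.Point) (hq : S.SameComponent (Sum.inl ⟨v, t⟩) q) :
    ∃ g : 𝒢.Gv v, q = Sum.inl ⟨v, (S.SV v).obj.ρ g t⟩ := by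
  -- the predicate "`q = (v, g · t)` for some `g`" is invariant along the adjacency relation
  have hstep : ∀ a b : S.Point, S.Adj a b →
      ((∃ g : 𝒢.Gv v, a = Sum.inl ⟨v, (S.SV v).obj.ρ g t⟩) ↔
        ∃ g : 𝒢.Gv v, b = Sum.inl ⟨v, (S.SV v).obj.ρ g t⟩) := by
    intro a b hab
    cases hab with
    | vertex w g x =>
      constructor
      · rintro ⟨g', hg'⟩
        obtain ⟨hw, hx⟩ := Sigma.mk.inj_iff.mp (Sum.inl.inj hg')
        subst hw
        obtain rfl := heq_iff_eq.mp hx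
        exact ⟨g * g', by rw [ρ_mul_apply]⟩
      · rintro ⟨g', hg'⟩
        obtain ⟨hw, hx⟩ := Sigma.mk.inj_iff.mp (Sum.inl.inj hg')
        subst hw
        have hx' := heq_iff_eq.mp hx
        refine ⟨g⁻¹ * g', ?_⟩
        rw [ρ_mul_apply, ← hx', ρ_inv_apply]
    | edge e g x => exact (IsEmpty.false e).elim
    | glue b w h x => exact ((Function.isEmpty 𝒢.graph.edgeOf).false b).elim
  have key : ∀ a b : S.Point, Relation.EqvGen S.Adj a b →
      ((∃ g : 𝒢.Gv v, a = Sum.inl ⟨v, (S.SV v).obj.ρ g t⟩) ↔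
        ∃ g : 𝒢.Gv v, b = Sum.inl ⟨v, (S.SV v).obj.ρ g t⟩) := by
    intro a b h
    induction h with
    | rel x y hxy => exact hstep x y hxy
    | refl x => exact Iff.rfl
    | symm x y _ ih => exact ih.symm
    | trans x y z _ _ ih₁ ih₂ => exact ih₁.trans ih₂
  exact (key _ _ hq).mp ⟨1, by rw [ρ_one_apply]⟩

/-- **Every covering of a one-vertex, edgeless semi-graph of anabelioids is tempered** (Def. 3.5 (ii)): the
stabiliser of `t ∈ S_v` is open, so it contains an open normal subgroup `N ⊴ Π_v` (`Π_v` is profinite);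
`N` then fixes every point `g · t` of the component of `t`, i.e. the finite covering `Π_v/N` splits that
component. [cite: MochizukiSemiAnbd2006, Def 3.5(ii) p.37] -/
theorem isTempered_covObj (S : CovObj 𝒢) : S.IsTempered := by
  intro p
  rcases p with ⟨v, t⟩ | ⟨e, _⟩
  · -- an open normal subgroup inside the (open) stabiliser of `t`
    have hU : IsOpen {g : 𝒢.Gv v | (S.SV v).obj.ρ g t = t} := (S.SV v).property.2 t
    have h1 : (1 : 𝒢.Gv v) ∈ {g : 𝒢.Gv v | (S.SV v).obj.ρ g t = t} := ρ_one_apply _ t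
    obtain ⟨N, hN⟩ := ProfiniteGrp.exist_openNormalSubgroup_sub_open_nhds_of_one hU h1
    -- the finite covering `Π_v/N`
    let Q : BTemp (𝒢.Gv v) := BTemp.quotientObj (𝒢.Gv v) IsTempered.of_profinite N.toSubgroup N.isOpen'
    refine ⟨covObjAt 𝒢 v Q, ⟨fun w => ?_, fun e => isEmptyElim e⟩,
      ⟨fun w => ?_, fun e => isEmptyElim e⟩, fun q hpq => ?_⟩
    · obtain rfl : v = w := Subsingleton.elim v w
      change Finite (𝒢.Gv v ⧸ N.toSubgroup)
      infer_instance
    · obtain rfl : v = w := Subsingleton.elim v w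
      exact ⟨((1 : 𝒢.Gv v) : 𝒢.Gv v ⧸ N.toSubgroup)⟩
    · obtain ⟨g, rfl⟩ := exists_eq_ρ_of_sameComponent 𝒢 S v t q hpq
      change ∀ (x : Q.obj.V) (g₁ : 𝒢.Gv v), Q.obj.ρ g₁ x = x →
        (S.SV v).obj.ρ g₁ ((S.SV v).obj.ρ g t) = (S.SV v).obj.ρ g t
      intro x g₁ hx
      have hg₁ : g₁ ∈ N.toSubgroup := mem_of_fix_quotientObj IsTempered.of_profinite N.toSubgroup N.isOpen' x g₁ hx
      -- `g⁻¹ g₁ g ∈ N` fixes `t`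
      have hc : g⁻¹ * g₁ * g ∈ N.toSubgroup := by
        have := N.isNormal'.conj_mem g₁ hg₁ g⁻¹
        simpa using this
      have hfix : (S.SV v).obj.ρ (g⁻¹ * g₁ * g) t = t := hN hc
      calc (S.SV v).obj.ρ g₁ ((S.SV v).obj.ρ g t)
          = (S.SV v).obj.ρ (g * (g⁻¹ * g₁ * g)) t := by
            rw [← ρ_mul_apply]; congr 1; group
        _ = (S.SV v).obj.ρ g t := by rw [ρ_mul_apply, hfix]
  · exact (IsEmpty.false e).elim

/-! ### `B^temp(𝒢) ≌ B^temp(Π_v)` by `S ↦ S_v` -/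

/-- `B^temp(Π_v) ⥤ B^temp(𝒢)`, `X ↦ covObjAt v X` (tempered by `isTempered_covObj`).
[cite: MochizukiSemiAnbd2006, Def 3.5(ii) p.37] -/
def extendAt (v : 𝒢.graph.Vertex) : BTemp (𝒢.Gv v) ⥤ BTempCat 𝒢 :=
  ObjectProperty.lift _ (covFunctorAt 𝒢 v) fun _ => isTempered_covObj 𝒢 _

/-- `B^temp(𝒢) ⥤ B^temp(Π_v)`, `S ↦ S_v` (the restriction to the vertex, Def. 3.5 (ii)).
[cite: MochizukiSemiAnbd2006, Def 3.5(ii) p.37] -/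
def restrictAt (v : 𝒢.graph.Vertex) : BTempCat 𝒢 ⥤ BTemp (𝒢.Gv v) :=
  ObjectProperty.ι _ ⋙ restrictV 𝒢 v

/-- A tempered covering is (isomorphic, by transported identity maps, to) the covering with its own fibre at
`v`. [cite: MochizukiSemiAnbd2006, Def 3.5(ii) p.37] -/
def unitIsoAt (v : 𝒢.graph.Vertex) (S : BTempCat 𝒢) :
    S ≅ (extendAt 𝒢 v).obj ((restrictAt 𝒢 v).obj S) :=
  ObjectProperty.isoMk _
    { hom :=
        { fV := fun w => (S.obj.castSVIso (Subsingleton.elim v w)).hom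
          fE := fun e => isEmptyElim e
          comm := fun b => (Function.isEmpty 𝒢.graph.edgeOf).elim b }
      inv :=
        { fV := fun w => (S.obj.castSVIso (Subsingleton.elim v w)).inv
          fE := fun e => isEmptyElim e
          comm := fun b => (Function.isEmpty 𝒢.graph.edgeOf).elim b }
      hom_inv_id := CovHom.ext (funext fun _ => (S.obj.castSVIso _).hom_inv_id) (funext fun e => isEmptyElim e)
      inv_hom_id := CovHom.ext (funext fun _ => (S.obj.castSVIso _).inv_hom_id) (funext fun e => isEmptyElim e) }

/-- **`B^temp(𝒢) ≌ B^temp(Π_v)`** via `S ↦ S_v`: a tempered covering of a one-vertex, edgeless semi-graph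
of anabelioids IS a countable discrete continuous `Π_v`-set (Prop. 3.6 (ii) for this `𝒢`, with `π₁^temp = Π_v`).
[cite: MochizukiSemiAnbd2006, Prop 3.6(ii) p.38] -/
def temperedEquivAt (v : 𝒢.graph.Vertex) : BTempCat 𝒢 ≌ BTemp (𝒢.Gv v) :=
  CategoryTheory.Equivalence.mk (restrictAt 𝒢 v) (extendAt 𝒢 v)
    (NatIso.ofComponents (unitIsoAt 𝒢 v) fun {_ _} f => ObjectProperty.hom_ext _
      (CovHom.ext (funext fun w => CovObj.castSVIso_hom_naturality f.hom (Subsingleton.elim v w))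
        (funext fun e => isEmptyElim e)))
    (NatIso.ofComponents (fun _ => Iso.refl _) fun _ => rfl)

/-- The functor of `temperedEquivAt v` is the restriction `S ↦ S_v` (definitionally).
[cite: MochizukiSemiAnbd2006, Prop 3.6(ii) p.38] -/
theorem temperedEquivAt_functor (v : 𝒢.graph.Vertex) :
    (temperedEquivAt 𝒢 v).functor = ObjectProperty.ι _ ⋙ restrictV 𝒢 v := rfl

/-- The inverse of `temperedEquivAt v` is `extendAt v` (definitionally). [cite: MochizukiSemiAnbd2006, Prop 3.6(ii) p.38] -/
theorem temperedEquivAt_inverse (v : 𝒢.graph.Vertex) : (temperedEquivAt 𝒢 v).inverse = extendAt 𝒢 v := rfl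

/-- `(extendAt v).obj X` restricted to `v` is `X` (definitionally). [cite: MochizukiSemiAnbd2006, Prop 3.6(ii) p.38] -/
@[simp] theorem restrictV_extendAt_obj (v : 𝒢.graph.Vertex) (X : BTemp (𝒢.Gv v)) :
    (restrictV 𝒢 v).obj ((extendAt 𝒢 v).obj X).obj = X := rfl

/-! ### The explicit chart `π₁^temp(𝒢) = Π_v` -/

/-- **The explicit tempered fundamental group chart of a one-vertex, edgeless semi-graph of anabelioids**:
`π₁^temp(𝒢)` may be taken to be the vertex group `Π_v` itself (tempered: Rmk. 3.1.1), with
`B^temp(𝒢) ≌ B^temp(Π_v)` the restriction to the vertex ([IUTchI] Rmk. 2.5.3 (i) (T6): `π₁^temp` is to be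
Galois-countable — `SecondCountableTopology Π_v`, a hypothesis). [cite: MochizukiSemiAnbd2006, Prop 3.6(ii) p.38] -/
def chartAt (v : 𝒢.graph.Vertex) [SecondCountableTopology (𝒢.Gv v)] : TemperedPiChart 𝒢 where
  G := 𝒢.Gv v
  isTempered := IsTempered.of_profinite
  secondCountableTopology := inferInstance
  equiv := temperedEquivAt 𝒢 v

/-- The group of the explicit chart is `Π_v` (definitionally). [cite: MochizukiSemiAnbd2006, Prop 3.6(ii) p.38] -/
theorem chartAt_G (v : 𝒢.graph.Vertex) [SecondCountableTopology (𝒢.Gv v)] : (chartAt 𝒢 v).G = 𝒢.Gv v := rfl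

/-- The equivalence of the explicit chart is `temperedEquivAt v` (definitionally).
[cite: MochizukiSemiAnbd2006, Prop 3.6(ii) p.38] -/
theorem chartAt_equiv (v : 𝒢.graph.Vertex) [SecondCountableTopology (𝒢.Gv v)] :
    (chartAt 𝒢 v).equiv = temperedEquivAt 𝒢 v := rfl

/-- For the explicit chart, `equiv.inverse ⋙ ι ⋙ restrictV v` is the identity functor of `B^temp(Π_v)`
(definitionally). [cite: MochizukiSemiAnbd2006, Thm 3.7(i) p.40] -/
theorem chartAt_inverse_comp_restrictV (v : 𝒢.graph.Vertex) [SecondCountableTopology (𝒢.Gv v)] :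
    (chartAt 𝒢 v).equiv.inverse ⋙ ObjectProperty.ι _ ⋙ restrictV 𝒢 v = 𝟭 (BTemp (𝒢.Gv v)) := rfl

end OneVertexEdgeless

/-! ### The edgeless single-vertex restriction `𝒢_{⟨{v}, ∅⟩}` of an arbitrary `𝒢` -/

variable (𝒢)

/-- The edgeless single-vertex sub-semi-graph `⟨{v}, ∅⟩` has exactly one vertex.
[cite: MochizukiSemiAnbd2006, Def. 2.1 p.24] -/
@[reducible] def uniqueVertexRestrictSingleton (v : 𝒢.graph.Vertex) :
    Unique (𝒢.restrict ⟨{v}, ∅⟩).graph.Vertex :=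
  Set.uniqueSingleton v

/-- … and no edge. [cite: MochizukiSemiAnbd2006, Def. 2.1 p.24] -/
theorem isEmpty_edge_restrictSingleton (v : 𝒢.graph.Vertex) :
    IsEmpty (𝒢.restrict ⟨{v}, ∅⟩).graph.Edge := by
  change IsEmpty (↥(∅ : Set 𝒢.graph.Edge))
  infer_instance

/-- The default vertex of `𝒢_{⟨{v}, ∅⟩}` is `v` (definitionally). [cite: MochizukiSemiAnbd2006, Def. 2.1 p.24] -/
theorem uniqueVertexRestrictSingleton_default (v : 𝒢.graph.Vertex) :
    ((uniqueVertexRestrictSingleton 𝒢 v).default : (𝒢.restrict ⟨{v}, ∅⟩).graph.Vertex) =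
      ⟨v, Set.mem_singleton v⟩ := rfl

/-- **The explicit chart of the edgeless single-vertex restriction `𝒢_{⟨{v}, ∅⟩}` with group `Π_v`**
(`OneVertexEdgeless.chartAt` at the vertex `⟨v, rfl⟩`). [cite: MochizukiSemiAnbd2006, Prop 3.6(ii) p.38] -/
def chartSingleVertex (v : 𝒢.graph.Vertex) [SecondCountableTopology (𝒢.Gv v)] :
    TemperedPiChart (𝒢.restrict ⟨{v}, ∅⟩) :=
  haveI := uniqueVertexRestrictSingleton 𝒢 v
  haveI := isEmpty_edge_restrictSingleton 𝒢 v
  haveI : SecondCountableTopology ((𝒢.restrict ⟨{v}, ∅⟩).Gv ⟨v, Set.mem_singleton v⟩) :=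
    ‹SecondCountableTopology (𝒢.Gv v)›
  OneVertexEdgeless.chartAt (𝒢.restrict ⟨{v}, ∅⟩) ⟨v, Set.mem_singleton v⟩

/-- The group of `chartSingleVertex 𝒢 v` is `Π_v` (definitionally). [cite: MochizukiSemiAnbd2006, Prop 3.6(ii) p.38] -/
theorem chartSingleVertex_G (v : 𝒢.graph.Vertex) [SecondCountableTopology (𝒢.Gv v)] :
    (chartSingleVertex 𝒢 v).G = 𝒢.Gv v := rfl

/-- The equivalence of `chartSingleVertex 𝒢 v` is the restriction to the vertex `⟨v, rfl⟩` of `𝒢_{⟨{v}, ∅⟩}`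
(definitionally). [cite: MochizukiSemiAnbd2006, Prop 3.6(ii) p.38] -/
theorem chartSingleVertex_equiv_functor (v : 𝒢.graph.Vertex) [SecondCountableTopology (𝒢.Gv v)] :
    (chartSingleVertex 𝒢 v).equiv.functor =
      ObjectProperty.ι _ ⋙ restrictV (𝒢.restrict ⟨{v}, ∅⟩) ⟨v, Set.mem_singleton v⟩ := rfl

/-- **The restriction `B^temp(𝒢) → B^temp(𝒢_{⟨{v}, ∅⟩})` read through `chartSingleVertex` IS the
restriction `S ↦ S_v` of Thm. 3.7 (i)** (definitionally: abc-iut-L3-t2's `covRestrict_comp_restrictV`).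
[cite: MochizukiSemiAnbd2006, Thm 3.7(i) p.40] -/
theorem btempRestrict_comp_chartSingleVertex_functor (v : 𝒢.graph.Vertex)
    [SecondCountableTopology (𝒢.Gv v)] :
    𝒢.btempRestrict ⟨{v}, ∅⟩ ⋙ (chartSingleVertex 𝒢 v).equiv.functor = ObjectProperty.ι _ ⋙ restrictV 𝒢 v :=
  rfl

/-- The same after precomposition with any functor (the shape of `IsDecompHom` vs `IsVerticialHom`).
[cite: MochizukiSemiAnbd2006, Thm 3.7(i) p.40] -/
theorem comp_btempRestrict_comp_chartSingleVertex_functor {C : Type*} [Category C] (F : C ⥤ BTempCat 𝒢)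
    (v : 𝒢.graph.Vertex) [SecondCountableTopology (𝒢.Gv v)] :
    F ⋙ 𝒢.btempRestrict ⟨{v}, ∅⟩ ⋙ (chartSingleVertex 𝒢 v).equiv.functor =
      F ⋙ ObjectProperty.ι _ ⋙ restrictV 𝒢 v :=
  rfl

end ProfiniteSemiGraph

end Literature.AnabelianGeometry.SemiGraphs
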